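import Mathlib
import Literature.MathematicalPhysics.StatisticalMechanics.TensorRGBoundaryMap
import Summits.CriticalPhenomena.CardyFormulaZ2.Theses.CardyTensorRG

/-!
# Iterated `2 × 2`-blocking covariance of open-rectangle networks
(helper for the support item RGToPolyominoLaw, stmt-CriticalPhenomena-14645, route CardyTensorRG)

Step (1) of the glue item RGToPolyominoLaw (card T4) uses that the lattice rectangle
`[0, m·2^k] × [0, n·2^k]` is EXACTLY `2^k`-blockable: iterating the one-step covariance axiom of a
boundary tensor RG map `R : TensorRGBoundaryMap w ρ` (`TensorRGBoundaryMap.covariance_step`,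
`Z_{2m × 2n}(X) = factor m n X · Z_{m × n}(step X)`) `k` times along an orbit that stays in the
domain expresses the fine partition function `Z_{m2^k × n2^k}(X)` as an explicit positive scalar
(the product of the blocking factors met along the orbit) times the coarse partition function
`Z_{m × n}(step^[k] X)` of the `k`-th iterate. This file proves that identity and the bookkeeping
around it, in the vocabulary of `Literature.MathematicalPhysics.StatisticalMechanics.TensorRGBoundaryMap`:

* `step_iterate_fst`, `step_iterate_snd_fst` — along the orbit the bulk component is `R.map^[j] T`
  and the bulk and boundary components do not depend on the corner data (two states differing only
  in their corner/twist tensors — as in the Baxter–Kelland–Wu crossing dictionary — have iterates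
  differing only in their corners);
* `partition_iterate` — the `k`-fold covariance identity;
* `prod_factor_pos` — the accumulated factor is positive on the domain;
* `partition_ratio_iterate` — for two states with the same bulk tensor the bulk normalisations
  `𝒩(R.map^[j] T)^{…}` cancel in the ratio of fine partition functions, leaving the accumulated
  boundary/corner factors and the coarse partition functions of the `k`-th iterates (the form in
  which crossing probabilities — ratios of rectangle partition functions, Cardy 1992 — are read
  along the RG orbit).
-/

namespace Summit.CriticalPhenomena.CardyFormulaZ2.Theorems

open Literature.MathematicalPhysics.StatisticalMechanics

variable {w : ℕ → ℝ} {G : Type*} [Group G] {ρ : Representation ℝ G FourTensor}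
  (R : TensorRGBoundaryMap w ρ)

/-- Along the boundary RG orbit the bulk component is the bulk orbit: `(step^[j] X).1 = 𝓡^[j] X.1`. -/
theorem step_iterate_fst (X : RectTensors) (j : ℕ) : (R.step^[j] X).1 = R.map^[j] X.1 := by
  induction j generalizing X with
  | zero => rfl
  | succ j ih =>
    rw [Function.iterate_succ_apply, Function.iterate_succ_apply, ih]
    rfl

/-- The bulk and boundary components of the iterates do not depend on the corner data: two states
with the same bulk and boundary tensors have iterates with the same bulk and boundary tensors. -/
theorem step_iterate_snd_fst (T : FourTensor) (B : Fin 4 → ThreeTensor) (K K' : Fin 4 → TwoTensor)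
    (j : ℕ) :
    (R.step^[j] (T, B, K)).1 = (R.step^[j] (T, B, K')).1 ∧
      (R.step^[j] (T, B, K)).2.1 = (R.step^[j] (T, B, K')).2.1 := by
  induction j generalizing T B K K' with
  | zero => exact ⟨rfl, rfl⟩
  | succ j ih =>
    simp only [Function.iterate_succ_apply]
    exact ih _ _ _ _

/-- If the first `k` points of the orbit of `X` are in the domain, then so are the first `k - 1`
points of the orbit of `step X` (re-indexing). -/
theorem inDomain_orbit_step {k : ℕ} {X : RectTensors}
    (horb : ∀ j < k + 1, R.InDomain (R.step^[j] X)) :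
    ∀ j < k, R.InDomain (R.step^[j] (R.step X)) := fun j hj => by
  rw [← Function.iterate_succ_apply]
  exact horb (j + 1) (by omega)

/-- **`k`-fold covariance.** For `m, n ≥ 1` and a state whose orbit stays in the domain for `k`
steps, `Z_{m2^k × n2^k}(X) = (∏_{j<k} factor (m 2^{k-1-j}) (n 2^{k-1-j}) (step^[j] X)) ·
Z_{m × n}(step^[k] X)`: the lattice rectangle of side lengths `m·2^k, n·2^k` is exactly
`2^k`-blockable. -/
theorem partition_iterate {m n : ℕ} (hm : 1 ≤ m) (hn : 1 ≤ n) (k : ℕ) (X : RectTensors)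
    (horb : ∀ j < k, R.InDomain (R.step^[j] X)) :
    X.partition w (m * 2 ^ k) (n * 2 ^ k) =
      (∏ j ∈ Finset.range k,
          R.factor (m * 2 ^ (k - (j + 1))) (n * 2 ^ (k - (j + 1))) (R.step^[j] X)) *
        (R.step^[k] X).partition w m n := by
  induction k generalizing X with
  | zero => simp
  | succ k ih =>
    have hX : R.InDomain X := horb 0 (Nat.succ_pos k)
    have hm' : 1 ≤ m * 2 ^ k := le_mul_of_le_of_one_le hm Nat.one_le_two_pow
    have hn' : 1 ≤ n * 2 ^ k := le_mul_of_le_of_one_le hn Nat.one_le_two_pow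
    have hcov := R.covariance_step (w := w) hm' hn' hX
    have e1 : m * 2 ^ (k + 1) = 2 * (m * 2 ^ k) := by ring
    have e2 : n * 2 ^ (k + 1) = 2 * (n * 2 ^ k) := by ring
    rw [e1, e2, hcov, ih (R.step X) (inDomain_orbit_step R horb), Finset.prod_range_succ',
      Function.iterate_succ_apply]
    have hprod : ∏ j ∈ Finset.range k,
          R.factor (m * 2 ^ (k - (j + 1))) (n * 2 ^ (k - (j + 1))) (R.step^[j] (R.step X)) =
        ∏ j ∈ Finset.range k,
          R.factor (m * 2 ^ (k + 1 - (j + 1 + 1))) (n * 2 ^ (k + 1 - (j + 1 + 1)))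
            (R.step^[j + 1] X) := by
      refine Finset.prod_congr rfl fun j _ => ?_
      rw [Function.iterate_succ_apply]
      have : k + 1 - (j + 1 + 1) = k - (j + 1) := by omega
      rw [this]
    rw [hprod]
    simp only [Function.iterate_zero_apply, Nat.add_sub_cancel]
    ring

/-- The accumulated blocking factor is positive when the orbit stays in the domain. -/
theorem prod_factor_pos {m n : ℕ} (k : ℕ) (X : RectTensors)
    (horb : ∀ j < k, R.InDomain (R.step^[j] X)) :
    0 < ∏ j ∈ Finset.range k,
        R.factor (m * 2 ^ (k - (j + 1))) (n * 2 ^ (k - (j + 1))) (R.step^[j] X) :=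
  Finset.prod_pos fun j hj => R.factor_pos _ _ (horb j (Finset.mem_range.1 hj))

/-- **Ratio form: the bulk normalisations cancel.** For two states with the SAME bulk tensor `T`
(and any boundary/corner data) whose orbits stay in the domain for `k` steps, the ratio of their
`m2^k × n2^k` partition functions equals the ratio of (accumulated boundary-and-corner factors ×
coarse `m × n` partition function of the `k`-th iterate): the bulk factors `𝒩(𝓡^[j] T)^{…}` are
common to both orbits and drop out. -/
theorem partition_ratio_iterate {m n : ℕ} (hm : 1 ≤ m) (hn : 1 ≤ n) (k : ℕ) {T : FourTensor}
    {B B' : Fin 4 → ThreeTensor} {K K' : Fin 4 → TwoTensor}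
    (horb : ∀ j < k, R.InDomain (R.step^[j] (T, B, K)))
    (horb' : ∀ j < k, R.InDomain (R.step^[j] (T, B', K'))) :
    rectPartition w (m * 2 ^ k) (n * 2 ^ k) T B K /
        rectPartition w (m * 2 ^ k) (n * 2 ^ k) T B' K' =
      ((∏ j ∈ Finset.range k,
          R.bcFactor (m * 2 ^ (k - (j + 1))) (n * 2 ^ (k - (j + 1))) (R.step^[j] (T, B, K))) *
        (R.step^[k] (T, B, K)).partition w m n) /
      ((∏ j ∈ Finset.range k,
          R.bcFactor (m * 2 ^ (k - (j + 1))) (n * 2 ^ (k - (j + 1))) (R.step^[j] (T, B', K'))) *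
        (R.step^[k] (T, B', K')).partition w m n) := by
  have h₁ := partition_iterate R hm hn k (T, B, K) horb
  have h₂ := partition_iterate R hm hn k (T, B', K') horb'
  simp only [RectTensors.partition_mk] at h₁ h₂
  -- the common bulk factor
  set P : ℝ := ∏ j ∈ Finset.range k,
      R.normalization (R.map^[j] T) ^ (m * 2 ^ (k - (j + 1)) * (n * 2 ^ (k - (j + 1)))) with hP
  have hfac : ∀ (B₀ : Fin 4 → ThreeTensor) (K₀ : Fin 4 → TwoTensor),
      (∏ j ∈ Finset.range k,
          R.factor (m * 2 ^ (k - (j + 1))) (n * 2 ^ (k - (j + 1))) (R.step^[j] (T, B₀, K₀))) =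
        P * ∏ j ∈ Finset.range k,
          R.bcFactor (m * 2 ^ (k - (j + 1))) (n * 2 ^ (k - (j + 1))) (R.step^[j] (T, B₀, K₀)) := by
    intro B₀ K₀
    rw [hP, ← Finset.prod_mul_distrib]
    refine Finset.prod_congr rfl fun j _ => ?_
    rw [TensorRGBoundaryMap.factor, step_iterate_fst R]
  have hPpos : 0 < P := by
    refine Finset.prod_pos fun j hj => pow_pos (R.normalization_pos _ ?_) _
    have h := (horb j (Finset.mem_range.1 hj)).1
    rwa [step_iterate_fst R] at h
  rw [h₁, h₂, hfac B K, hfac B' K', mul_assoc, mul_assoc, mul_div_mul_left _ _ hPpos.ne']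

end Summit.CriticalPhenomena.CardyFormulaZ2.Theorems
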